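import Literature.NumberTheory.Automorphic.UnitaryThreeRamifiedTorusBlocks          -- ★/GREEN γ2′ PART 1 (reps, torus blocks, 1-units are norms, assembly)
import HarnessLib

/-!
# Flicker's Proposition 6 (a), RAMIFIED torus, in the `U(Φ₃)` frame: `H = ⋃_n T_H · r_n · K_H` for the type-(2) torus
(Flicker (1998), *Elementary proof of the fundamental lemma for a unitary group*, Prop. 6 (second half) p. 83: `H = ⊔_j T_H r_j K_H` for
`T_H ≅ (EL)¹`, `L∕F` ramified, `r_j = (0 1;1 0)^j·diag(1, (−π)^j)`-type representatives; REMARK p. 84)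

Topic `NumberTheory/Automorphic`; namespace `Literature.NumberTheory.Automorphic.UnitaryGroup`.  KERNEL mathematics only: theorems, no definition, no
named fact, no instance, no notation, no `sorry`.  Cell `pub/hodgecm-mathlib`, programme P3a, road «D-N7-inert», MAP v3 «N7-ns COUNT FROM FLICKER», brick
γ2′ «THE RAMIFIED ∕ TYPE-(2) TRANSPORT» (LEAD F0P3a-plan (g9) T8-84 (2); B-p04 (g33) 06:04:43Z «=» on (D1)–(D3); consumer: A-p03 (g24)'s `B_H` adapter and
B-p04's ★ p840967 `FixedPointsTorusDoubleCosetCount` at the type-(2) torus) — FILE `hA′` PART 2 (existence of the decomposition; PART 1 =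
`UnitaryThreeRamifiedTorusBlocks`: representatives, torus blocks, 1-units are norms, assembly).  Companion of ★ `hB′`
`UnitaryThreeRamifiedTorusDoubleCosetsHKDisjoint` (same representatives `r`).  HC_CM is proved only modulo the printed citations (2 remaining named inputs
hLiu418, h413) until rung 0 closes; this file discharges no named fact.

MATHEMATICS.  `t′ = !![A,0,B;0,b₀,0;C,0,A] ∈ H`, `C ≠ 0`, `B = C·ρ`, `|ρ| = |ϖ|`; `Z_H(t′)`-corners are `(p, ρq; q, p)` (★ γ2a).  Through ★ γ0's dictionary
`corner = λ·D₁⁻¹ g₀ D₁` (`g₀ ∈ GL₂(F)`, `F = K^σ`, `D₁ = diag(1, d⁻¹)`) the torus becomes `ι(L^×)`, `ι(x + y√π₀) = (x, π₀y; y, x)`, for the RAMIFIED quadratic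
algebra `L = F(√π₀)`, **`π₀ := d²ρ`** (a uniformizer of `F`; Flicker's `π` when `w = (0, π∕√D; √D, 0)`).  MARS' lemma for the order `𝒪_F[√π₀]` — taken here as
the ONE `K`-side binder `hMars` (B-p04's ★ γ1′ `RamifiedQuadraticLatticeDoubleCosets` + an `AdjoinRoot` adapter, a named residual of the programme; no type
`L` appears) — writes the scaled `g₀` as `ι(z)·diag(1, π₀^i)·k₀`, `k₀ ∈ GL₂(𝒪_F)`.  Unitarity `|det corner| = 1` fixes the PARITY of `i` by the parity of
`v(N_{L∕F} z)`: if `|u| ≥ |v|` (`z = u + v√π₀`) then `N z = u²·ν`, `ν ≡ 1 (𝔪)`, `i = 2a`, and `τ := (uμ)⁻¹·D₁⁻¹ι(z)D₁ ⊕ 1 ∈ T_H` with `μσμ = ν`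
(1-units are norms, ★ Serre V §2 Prop. 3 — discharged, whence `[IsAdicComplete 𝔪 R]`), `k := r(2a)⁻¹τ⁻¹g` integral; if `|u| < |v|` then `z ↦ z√π₀`,
`N(z√π₀) = (π₀v)²·ν′`, `i = 2a+1`, the radial part `√π₀⁻¹·diag(1,π₀^i) = (0, π₀^i; π₀⁻¹, 0)` is `r(2a+1)` up to `K_H`, `r(2a+1)` with corner
`(0, ϖ^{a+1}∕d; −dϖ^{−(a+1)}, 0)`.  Hence `g = τ·r_n·k`: the binder `hA` of ★ p840967 at the type-(2) torus.

References: [Flicker1998UnitaryFL] Y. Z. Flicker, Canad. J. Math. 50 (1998), Prop. 6 p. 83, REMARK p. 84 · [Serre1979] J.-P. Serre, *Local Fields*, GTM 67,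
Ch. V §2 Prop. 3 · [Rogawski1990] J. D. Rogawski, Ann. of Math. Stud. 123, §4.9 p. 55. -/

set_option autoImplicit false

open Matrix
open scoped MatrixGroups WithZero

namespace Literature.NumberTheory.Automorphic.UnitaryGroup

open Literature.NumberTheory.Automorphic.HermitianLattice (unitaryInt LocalConjDatum)
universe u

/-! ## Flicker's Prop. 6 (a) for the ramified torus -/

section Main

variable {K : Type*} [Field K] [Valued K ℤᵐ⁰] {ϖ : K} (σ : K →+* K) {J : Matrix (Fin 3) (Fin 3) K}
  (hJ : J = (StdForm.antidiagonal 3).over K) (hd : LocalConjDatum σ ϖ)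

/-- Discreteness: `x < y` in `ℤᵐ⁰` gives `x² ≤ exp(−2)·y²`. [cite: Flicker1998UnitaryFL, Prop. 6 p. 83] -/
private theorem sq_le_exp_neg_two_mul_sq {x y : ℤᵐ⁰} (h : x < y) : x ^ 2 ≤ WithZero.exp (-2 : ℤ) * y ^ 2 := by
  by_cases hx : x = 0
  · rw [hx, zero_pow two_ne_zero]; exact zero_le
  have hy : y ≠ 0 := ne_zero_of_lt h
  rw [← WithZero.exp_log hx, ← WithZero.exp_log hy, WithZero.exp_lt_exp] at h
  rw [← WithZero.exp_log hx, ← WithZero.exp_log hy, ← WithZero.exp_nsmul, ← WithZero.exp_nsmul, ← WithZero.exp_add, WithZero.exp_le_exp]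
  simp only [nsmul_eq_mul]; push_cast; omega

set_option maxHeartbeats 1600000 in
-- one long explicit computation (Flicker's Prop. 6 (a), ramified torus); the `field_simp`/`linear_combination` entry identities dominate
include hJ hd in
/-- **FLICKER'S PROPOSITION 6 (a), RAMIFIED TORUS — `H = ⋃_n T_H · r_n · K_H`** in the `U(Φ₃)` frame: `T_H = Z_H(t′)` for a regular type-(2) torus block
`t′ = !![A,0,B;0,b₀,0;C,0,A]` (`C ≠ 0`, `B = Cρ`, `|ρ| = |ϖ|`), representatives `r(2a) = diag(ϖ^{−a},1,ϖ^{a})`, `r(2a+1)` with corner `(0, ϖ^{a+1}∕d; −dϖ^{−(a+1)}, 0)`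
(`d = ι d_R`), `K_H = flickerKH`: every `g ∈ H` is `τ · r_n · k` — the binder `hA` of ★ `FixedPointsTorusDoubleCosetCount` at the type-(2) torus, VERBATIM at
`G := ↥H`.  HYPOTHESIS `hMars` = Mars' lemma for the ramified order `𝒪_F[√π₀]`, `π₀ = d²ρ`, read in `K` (`g = ι(z)·diag(1,π₀^i)·k₀` entrywise for `σ`-fixed
integral `g` with `det g ≠ 0`) — the programme's named residual (★ γ1′ + adjoin-root adapter).  `R` is assumed `𝔪`-adically complete (1-units are norms).
[cite: Flicker1998UnitaryFL, Prop. 6 p. 83; REMARK p. 84] [cite: Serre1979, Ch. V §2 Prop. 3] -/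
theorem exists_mem_centralizer_mul_ramifiedRep_mul_mem_flickerKH
    {R : Type u} [CommRing R] [IsDomain R] [IsDiscreteValuationRing R] [IsAdicComplete (IsLocalRing.maximalIdeal R) R]
    (ι : R →+* K) (hι : Function.Injective ι)
    (hιv : ∀ x : K, Valued.v x ≤ 1 ↔ x ∈ Set.range ι) (σR : R →+* R) (hσR : ∀ r, σR (σR r) = r) (hσι : ∀ r, ι (σR r) = σ (ι r))
    {dR : R} (hdRσ : σR dR = -dR) (hdRu : IsUnit dR) (h2R : IsUnit (2 : R))
    {c : ↥(unitaryGroupOfForm σ J)} (hc : ((c : GL (Fin 3) K) : Matrix (Fin 3) (Fin 3) K) = !![1, 0, 0; 0, -1, 0; 0, 0, 1])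
    {ρ π₀ : K} (hρ : Valued.v ρ = Valued.v ϖ) (hπ₀ : π₀ = ι dR ^ 2 * ρ)
    (hMars : ∀ G : Matrix (Fin 2) (Fin 2) K, (∀ a b, σ (G a b) = G a b) → (∀ a b, Valued.v (G a b) ≤ 1) →
      G 0 0 * G 1 1 - G 0 1 * G 1 0 ≠ 0 →
      ∃ (u v : K) (i : ℕ) (U₀ U₁ W₀ W₁ : K), σ u = u ∧ σ v = v ∧
        Valued.v U₀ ≤ 1 ∧ Valued.v U₁ ≤ 1 ∧ Valued.v W₀ ≤ 1 ∧ Valued.v W₁ ≤ 1 ∧ Valued.v (U₀ * W₁ - U₁ * W₀) = 1 ∧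
        G 0 0 = u * U₀ + π₀ * v * (π₀ ^ i * W₀) ∧ G 1 0 = v * U₀ + u * (π₀ ^ i * W₀) ∧
        G 0 1 = u * U₁ + π₀ * v * (π₀ ^ i * W₁) ∧ G 1 1 = v * U₁ + u * (π₀ ^ i * W₁))
    {t : ↥(unitaryGroupOfForm σ J)} (htH : t ∈ Subgroup.centralizer ({c} : Set ↥(unitaryGroupOfForm σ J))) {A B C b₀ : K}
    (hte : ((t : GL (Fin 3) K) : Matrix (Fin 3) (Fin 3) K) = !![A, 0, B; 0, b₀, 0; C, 0, A]) (hC : C ≠ 0) (hBC : B = C * ρ)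
    (r : ℕ → ↥(Subgroup.centralizer ({c} : Set ↥(unitaryGroupOfForm σ J))))
    (hr0 : ∀ a : ℕ, (((r (2 * a) : ↥(unitaryGroupOfForm σ J)) : GL (Fin 3) K) : Matrix (Fin 3) (Fin 3) K) =
      !![(ϖ ^ a)⁻¹, 0, 0; 0, 1, 0; 0, 0, ϖ ^ a])
    (hr1 : ∀ a : ℕ, (((r (2 * a + 1) : ↥(unitaryGroupOfForm σ J)) : GL (Fin 3) K) : Matrix (Fin 3) (Fin 3) K) =
      !![0, 0, ϖ ^ (a + 1) / ι dR; 0, 1, 0; -ι dR * (ϖ ^ (a + 1))⁻¹, 0, 0])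
    (g : ↥(Subgroup.centralizer ({c} : Set ↥(unitaryGroupOfForm σ J)))) :
    ∃ n : ℕ, ∃ τ ∈ Subgroup.centralizer ({⟨t, htH⟩} : Set ↥(Subgroup.centralizer ({c} : Set ↥(unitaryGroupOfForm σ J)))),
      ∃ k ∈ (flickerKH σ J c).subgroupOf (Subgroup.centralizer ({c} : Set ↥(unitaryGroupOfForm σ J))), g = τ * r n * k := by
  classical
  -- scalar facts
  have h2 : (2 : K) ≠ 0 := fun h0 => by have := hd.v2; rw [h0, map_zero] at this; exact zero_ne_one this
  have hϖ0 : ϖ ≠ 0 := fun h0 => by have := hd.vϖ; rw [h0, map_zero] at this; exact WithZero.zero_ne_coe this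
  have hvϖ := hd.vϖ
  have hσϖ : σ ϖ = ϖ := hd.σϖ
  set d : K := ι dR with hd_def
  have hdK : σ d = -d := by rw [hd_def, ← hσι, hdRσ, map_neg]
  have hvd : Valued.v d = 1 := TorusBridge.v_eq_one_of_isUnit ι hιv hdRu
  have hd0 : d ≠ 0 := fun h0 => by rw [h0, map_zero] at hvd; exact zero_ne_one hvd
  have hvπ₀ : Valued.v π₀ = WithZero.exp (-1 : ℤ) := by rw [hπ₀, map_mul, map_pow, hvd, one_pow, one_mul, hρ, hvϖ]
  have hπ₀0 : π₀ ≠ 0 := fun h0 => by rw [h0, map_zero] at hvπ₀; exact WithZero.zero_ne_coe hvπ₀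
  have hexp0 : WithZero.exp (-1 : ℤ) ≠ 0 := WithZero.coe_ne_zero
  -- `σ π₀ = π₀` from `t ∈ H` (★ γ0 dictionary for `t`)
  have ht3 : ((t : GL (Fin 3) K)) ∈ unitaryGroupOfForm σ ((StdForm.antidiagonal 3).over K) := by rw [← hJ]; exact t.2
  obtain ⟨⟨lt, hlt0, -, -, f2t, f3t, -, -⟩, -⟩ := SplitDictionary.exists_fixed_coords_of_coe_eq_block σ h2 hdK hd0 ht3 hte
  have hσπ₀ : σ π₀ = π₀ := by
    have e1 : π₀ = (d * B / lt) / (C / (d * lt)) := by rw [hπ₀, hBC]; field_simp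
    rw [e1, map_div₀, f2t, f3t]
  -- Step 1: block shape and the dictionary for `g`
  obtain ⟨α, β, γ, δ, e, hg⟩ := exists_coe_eq_block_of_mem_centralizer σ h2 hc g.2
  have hg3 : ((g : ↥(unitaryGroupOfForm σ J)) : GL (Fin 3) K) ∈ unitaryGroupOfForm σ ((StdForm.antidiagonal 3).over K) := by
    rw [← hJ]; exact (g : ↥(unitaryGroupOfForm σ J)).2
  obtain ⟨⟨l, hl0, hl, f1, f2, f3, f4, -⟩, he⟩ := SplitDictionary.exists_fixed_coords_of_coe_eq_block σ h2 hdK hd0 hg3 hg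
  have hΔ : α * δ - β * γ ≠ 0 := fun h0 => hl0 (by rw [← hl, h0, zero_mul])
  -- Step 2: scale `g₀` into the integers and apply MARS (ramified order)
  obtain ⟨N, hN1, hN2, hN3, hN4⟩ := exists_v_pow_mul_le_one₄ hvϖ (α / l) (d * β / l) (γ / (d * l)) (δ / l)
  have hσϖN : σ (ϖ ^ N) = ϖ ^ N := by rw [map_pow, hσϖ]
  obtain ⟨u, v, i, U₀, U₁, W₀, W₁, hu, hv, hvU₀, hvU₁, hvW₀, hvW₁, hvk, E00, E10, E01, E11⟩ :=
    hMars !![ϖ ^ N * (α / l), ϖ ^ N * (d * β / l); ϖ ^ N * (γ / (d * l)), ϖ ^ N * (δ / l)]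
      (by intro a b; fin_cases a <;> fin_cases b <;> simp [map_mul, hσϖN, f1, f2, f3, f4])
      (by
        intro a b
        fin_cases a <;> fin_cases b
        · exact hN1
        · exact hN2
        · exact hN3
        · exact hN4)
      (by
        simp only [of_apply, cons_val', cons_val_zero, cons_val_one, empty_val', cons_val_fin_one]
        have : ϖ ^ N * (α / l) * (ϖ ^ N * (δ / l)) - ϖ ^ N * (d * β / l) * (ϖ ^ N * (γ / (d * l))) =
            (ϖ ^ N) ^ 2 * (α * δ - β * γ) / l ^ 2 := by field_simp
        rw [this]
        exact div_ne_zero (mul_ne_zero (pow_ne_zero _ (pow_ne_zero _ hϖ0)) hΔ) (pow_ne_zero _ hl0))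
  simp only [of_apply, cons_val', cons_val_zero, cons_val_one, empty_val', cons_val_fin_one] at E00 E10 E01 E11
  -- Step 3: entries of `g`, the determinant identity, `|αδ − βγ| = 1`
  have hϖN0 : ϖ ^ N ≠ 0 := pow_ne_zero _ hϖ0
  have eα : α = l * (u * U₀ + π₀ * v * (π₀ ^ i * W₀)) / ϖ ^ N := by
    have h := E00
    field_simp at h
    rw [eq_div_iff hϖN0]
    linear_combination h
  have eβ : β = l * (u * U₁ + π₀ * v * (π₀ ^ i * W₁)) / (d * ϖ ^ N) := by
    have h := E01
    field_simp at h
    rw [eq_div_iff (mul_ne_zero hd0 hϖN0)]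
    linear_combination h
  have eγ : γ = l * d * (v * U₀ + u * (π₀ ^ i * W₀)) / ϖ ^ N := by
    have h := E10
    field_simp at h
    rw [eq_div_iff hϖN0]
    linear_combination h
  have eδ : δ = l * (v * U₁ + u * (π₀ ^ i * W₁)) / ϖ ^ N := by
    have h := E11
    field_simp at h
    rw [eq_div_iff hϖN0]
    linear_combination h
  have hdetId : (α * δ - β * γ) * (ϖ ^ N) ^ 2 = l ^ 2 * π₀ ^ i * (U₀ * W₁ - U₁ * W₀) * (u * u - π₀ * v * v) := by
    rw [eα, eβ, eγ, eδ]; field_simp; ring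
  have hvl0 : Valued.v l ≠ 0 := (Valuation.ne_zero_iff _).2 hl0
  have hvΔ : Valued.v (α * δ - β * γ) = 1 := by
    have h1 := congrArg Valued.v hl
    rw [map_mul, hd.vσ l] at h1
    exact mul_right_cancel₀ hvl0 (by rw [h1, one_mul])
  have huv : u ≠ 0 ∨ v ≠ 0 := by
    by_contra h0
    push Not at h0
    obtain ⟨hu0, hv0⟩ := h0
    apply hΔ
    rw [eα, eβ, eγ, eδ, hu0, hv0]; ring
  have he1 : Valued.v e = 1 := by
    have h1 := congrArg Valued.v he
    rw [map_mul, hd.vσ, map_one] at h1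
    exact Literature.NumberTheory.QuadraticForms.OMeara65.WithZeroMulInt.eq_one_of_mul_self h1
  -- Step 4: the parity of `v(N_{L∕F} z)` decides the representative family
  rcases le_or_gt (Valued.v v) (Valued.v u) with hcase | hcase
  · -- CASE A: `|v| ≤ |u|`, `N z = u²·ν` with `ν ≡ 1`, `i = 2a`
    have hu0 : u ≠ 0 := by
      rcases huv with h | h
      · exact h
      · intro h0; rw [h0, map_zero, le_zero_iff] at hcase; exact h ((map_eq_zero _).1 hcase)
    have hvu0 : Valued.v u ≠ 0 := (Valuation.ne_zero_iff _).2 hu0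
    have hνlt : Valued.v ((1 - π₀ * (v / u) ^ 2) - 1) < 1 := by
      have e1 : (1 - π₀ * (v / u) ^ 2) - 1 = -(π₀ * (v / u) ^ 2) := by ring
      rw [e1, Valuation.map_neg, map_mul, map_pow, map_div₀, hvπ₀]
      have hq : Valued.v v / Valued.v u ≤ 1 := div_le_one_of_le₀ hcase zero_le
      calc WithZero.exp (-1 : ℤ) * (Valued.v v / Valued.v u) ^ 2 ≤ WithZero.exp (-1 : ℤ) * 1 :=
            mul_le_mul_right (pow_le_one₀ zero_le hq) _
        _ < 1 := by rw [mul_one, ← WithZero.exp_zero, WithZero.exp_lt_exp]; norm_num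
    have hν1 : Valued.v (1 - π₀ * (v / u) ^ 2) = 1 := by
      have e1 : 1 - π₀ * (v / u) ^ 2 = 1 + ((1 - π₀ * (v / u) ^ 2) - 1) := by ring
      rw [e1]; exact Valuation.map_one_add_of_lt _ hνlt
    obtain ⟨μ, hμ, hvμ⟩ := exists_mul_map_eq_of_v_sub_one_lt σ ι hι hιv σR hσR hσι h2R (x := 1 - π₀ * (v / u) ^ 2)
      (by rw [map_sub, map_one, map_mul, map_pow, map_div₀, hσπ₀, hv, hu]) hνlt
    have hμ0 : μ ≠ 0 := fun h0 => by rw [h0, map_zero] at hvμ; exact zero_ne_one hvμ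
    have hσμ0 : σ μ ≠ 0 := by
      intro h0
      have h1 := hν1
      rw [← hμ, h0, mul_zero, map_zero] at h1
      exact zero_ne_one h1
    have hn : u * u - π₀ * v * v = u ^ 2 * (1 - π₀ * (v / u) ^ 2) := by field_simp
    -- parity from the determinant identity
    have hpar : (i : ℤ) = 2 * ((N : ℤ) + WithZero.log (Valued.v l) + WithZero.log (Valued.v u)) := by
      have h1 := congrArg Valued.v hdetId
      rw [hn] at h1
      simp only [map_mul, map_pow, hvϖ, hvΔ, hvπ₀, hvk, hν1, one_mul, mul_one] at h1
      rw [← WithZero.exp_log hvl0, ← WithZero.exp_log hvu0] at h1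
      simp only [← WithZero.exp_nsmul, ← WithZero.exp_add, WithZero.exp_inj, nsmul_eq_mul] at h1
      push_cast at h1
      linarith
    obtain ⟨a, hia, ha⟩ : ∃ a : ℕ, i = 2 * a ∧ (a : ℤ) = (N : ℤ) + WithZero.log (Valued.v l) + WithZero.log (Valued.v u) := by
      have hM : (0 : ℤ) ≤ (N : ℤ) + WithZero.log (Valued.v l) + WithZero.log (Valued.v u) := by omega
      refine ⟨((N : ℤ) + WithZero.log (Valued.v l) + WithZero.log (Valued.v u)).toNat, ?_, Int.toNat_of_nonneg hM⟩
      have := Int.toNat_of_nonneg hM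
      omega
    -- the torus element `τ := (uμ)⁻¹·D₁⁻¹ι(z)D₁ ⊕ 1`
    set lam : K := (u * μ)⁻¹ with hlam
    have hN' : lam * σ lam * (u * u - π₀ * v * v) = 1 := by
      rw [hlam, map_inv₀, map_mul, hu, hn]
      have e1 : u ^ 2 * (1 - π₀ * (v / u) ^ 2) = u * u * (μ * σ μ) := by rw [hμ]; ring
      rw [e1]; field_simp
    obtain ⟨τ, hτ⟩ := exists_coe_eq_ramifiedTorusBlock σ hJ hdK hd0 hu hv hσπ₀ hN'
    have hτc : τ ∈ Subgroup.centralizer ({c} : Set ↥(unitaryGroupOfForm σ J)) := mem_centralizer_of_coe_eq_block σ hc hτ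
    have hτt : τ ∈ Subgroup.centralizer ({t} : Set ↥(unitaryGroupOfForm σ J)) := ramifiedTorusBlock_mem_centralizer σ hd0 hτ hte hC hBC hπ₀
    -- the element `k := r(2a)⁻¹ τ⁻¹ g` and its matrix
    have hϖa0 : ϖ ^ a ≠ 0 := pow_ne_zero _ hϖ0
    set m : K := l * u * μ * ϖ ^ a / ϖ ^ N with hm
    have hvm : Valued.v m = 1 := by
      rw [hm, map_div₀, map_mul, map_mul, map_mul, map_pow, map_pow, hvϖ, hvμ, mul_one, ← WithZero.exp_log hvl0, ← WithZero.exp_log hvu0]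
      simp only [← WithZero.exp_nsmul, ← WithZero.exp_add, ← WithZero.exp_sub, nsmul_eq_mul]
      rw [show WithZero.log (Valued.v l) + WithZero.log (Valued.v u) + (a : ℤ) * -1 - (N : ℤ) * -1 = 0 by linarith, WithZero.exp_zero]
    set ε₀ : K := π₀ ^ (2 * a) / (ϖ ^ a) ^ 2 with hε₀
    have hvε₀ : Valued.v ε₀ = 1 := by
      rw [hε₀, map_div₀, map_pow, map_pow, map_pow, hvπ₀, hvϖ, ← pow_mul, mul_comm a 2, div_self (pow_ne_zero _ hexp0)]
    have hia' : π₀ ^ i = ε₀ * (ϖ ^ a) ^ 2 := by rw [hε₀, hia, div_mul_cancel₀ _ (pow_ne_zero _ hϖa0)]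
    let kM : Matrix (Fin 3) (Fin 3) K := !![m * U₀, 0, m * U₁ / d; 0, e, 0; m * d * (ε₀ * W₀), 0, m * (ε₀ * W₁)]
    have hprod : ((τ : GL (Fin 3) K) : Matrix (Fin 3) (Fin 3) K) *
        (((r (2 * a) : ↥(unitaryGroupOfForm σ J)) : GL (Fin 3) K) : Matrix (Fin 3) (Fin 3) K) * kM =
        (((g : ↥(unitaryGroupOfForm σ J)) : GL (Fin 3) K) : Matrix (Fin 3) (Fin 3) K) := by
      rw [hτ, hr0 a, block_mul_block, hg]
      simp only [kM, block_mul_block]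
      have c00 : lam * u * (ϖ ^ a)⁻¹ * (m * U₀) + lam * (π₀ * v) / d * ϖ ^ a * (m * d * (ε₀ * W₀)) = α := by
        rw [eα, hm, hia', hlam]; field_simp
      have c02 : lam * u * (ϖ ^ a)⁻¹ * (m * U₁ / d) + lam * (π₀ * v) / d * ϖ ^ a * (m * (ε₀ * W₁)) = β := by
        rw [eβ, hm, hia', hlam]; field_simp
      have c20 : lam * v * d * (ϖ ^ a)⁻¹ * (m * U₀) + lam * u * ϖ ^ a * (m * d * (ε₀ * W₀)) = γ := by
        rw [eγ, hm, hia', hlam]; field_simp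
      have c22 : lam * v * d * (ϖ ^ a)⁻¹ * (m * U₁ / d) + lam * u * ϖ ^ a * (m * (ε₀ * W₁)) = δ := by
        rw [eδ, hm, hia', hlam]; field_simp
      ext a' b'
      fin_cases a' <;> fin_cases b' <;> simp <;>
        first | linear_combination c00 | linear_combination c02 | linear_combination c20 | linear_combination c22
    obtain ⟨τ', hτ', k, hk, hgk⟩ := exists_eq_centralizer_mul_rep_mul_flickerKH σ hJ hd r (2 * a) g htH hτc hτt hprod (by
      intro a' b'
      fin_cases a' <;> fin_cases b' <;> simp [kM, hvm, hvd, he1, hvε₀, hvU₀, hvU₁, hvW₀, hvW₁])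
    exact ⟨2 * a, τ', hτ', k, hk, hgk⟩
  · -- CASE B: `|u| < |v|`, `z ↦ z√π₀`: `N(z√π₀) = (π₀v)²·ν′` with `ν′ ≡ 1`, `i = 2a+1`
    have hvv0 : Valued.v v ≠ 0 := ne_zero_of_lt hcase
    have hv0 : v ≠ 0 := (Valuation.ne_zero_iff _).1 hvv0
    have hνlt : Valued.v ((1 - (u / v) ^ 2 / π₀) - 1) < 1 := by
      have e1 : (1 - (u / v) ^ 2 / π₀) - 1 = -((u / v) ^ 2 / π₀) := by ring
      rw [e1, Valuation.map_neg, map_div₀, map_pow, map_div₀, hvπ₀, div_pow]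
      have h1 : Valued.v u ^ 2 / Valued.v v ^ 2 ≤ WithZero.exp (-2 : ℤ) := by
        rw [div_le_iff₀ (pos_of_ne_zero (pow_ne_zero _ hvv0))]
        exact sq_le_exp_neg_two_mul_sq hcase
      calc Valued.v u ^ 2 / Valued.v v ^ 2 / WithZero.exp (-1 : ℤ) ≤ WithZero.exp (-2 : ℤ) / WithZero.exp (-1 : ℤ) := by
            gcongr; exact zero_le
        _ < 1 := by rw [← WithZero.exp_sub, ← WithZero.exp_zero, WithZero.exp_lt_exp]; norm_num
    have hν1 : Valued.v (1 - (u / v) ^ 2 / π₀) = 1 := by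
      have e1 : 1 - (u / v) ^ 2 / π₀ = 1 + ((1 - (u / v) ^ 2 / π₀) - 1) := by ring
      rw [e1]; exact Valuation.map_one_add_of_lt _ hνlt
    obtain ⟨μ, hμ, hvμ⟩ := exists_mul_map_eq_of_v_sub_one_lt σ ι hι hιv σR hσR hσι h2R (x := 1 - (u / v) ^ 2 / π₀)
      (by rw [map_sub, map_one, map_div₀, map_pow, map_div₀, hσπ₀, hv, hu]) hνlt
    have hμ0 : μ ≠ 0 := fun h0 => by rw [h0, map_zero] at hvμ; exact zero_ne_one hvμ
    have hσμ0 : σ μ ≠ 0 := by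
      intro h0
      have h1 := hν1
      rw [← hμ, h0, mul_zero, map_zero] at h1
      exact zero_ne_one h1
    have hn : u * u - π₀ * v * v = -(π₀ * v ^ 2 * (1 - (u / v) ^ 2 / π₀)) := by field_simp; ring
    -- parity from the determinant identity
    have hpar : (i : ℤ) + 1 = 2 * ((N : ℤ) + WithZero.log (Valued.v l) + WithZero.log (Valued.v v)) := by
      have h1 := congrArg Valued.v hdetId
      rw [hn] at h1
      simp only [map_mul, map_pow, Valuation.map_neg, hvϖ, hvΔ, hvπ₀, hvk, hν1, one_mul, mul_one] at h1
      rw [← WithZero.exp_log hvl0, ← WithZero.exp_log hvv0] at h1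
      simp only [← WithZero.exp_nsmul, ← WithZero.exp_add, WithZero.exp_inj, nsmul_eq_mul] at h1
      push_cast at h1
      linarith
    obtain ⟨a, hia, ha⟩ : ∃ a : ℕ, i = 2 * a + 1 ∧ (a : ℤ) + 1 = (N : ℤ) + WithZero.log (Valued.v l) + WithZero.log (Valued.v v) := by
      have hM : (1 : ℤ) ≤ (N : ℤ) + WithZero.log (Valued.v l) + WithZero.log (Valued.v v) := by omega
      refine ⟨((N : ℤ) + WithZero.log (Valued.v l) + WithZero.log (Valued.v v) - 1).toNat, ?_, ?_⟩
      · have := Int.toNat_of_nonneg (show (0 : ℤ) ≤ (N : ℤ) + WithZero.log (Valued.v l) + WithZero.log (Valued.v v) - 1 by omega)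
        omega
      · have := Int.toNat_of_nonneg (show (0 : ℤ) ≤ (N : ℤ) + WithZero.log (Valued.v l) + WithZero.log (Valued.v v) - 1 by omega)
        omega
    -- the torus element `τ := (π₀vμ)⁻¹·D₁⁻¹ι(z√π₀)D₁ ⊕ 1`, `ι(z√π₀) = (π₀v, π₀u; u, π₀v)`
    set lam : K := (π₀ * v * μ)⁻¹ with hlam
    have hσπv : σ (π₀ * v) = π₀ * v := by rw [map_mul, hσπ₀, hv]
    have hN' : lam * σ lam * (π₀ * v * (π₀ * v) - π₀ * u * u) = 1 := by
      rw [hlam, map_inv₀, map_mul, hσπv]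
      have e1 : π₀ * v * (π₀ * v) - π₀ * u * u = π₀ * v * (π₀ * v) * (μ * σ μ) := by rw [hμ]; field_simp
      rw [e1]; field_simp
    obtain ⟨τ, hτ⟩ := exists_coe_eq_ramifiedTorusBlock σ hJ hdK hd0 hσπv hu hσπ₀ hN'
    have hτc : τ ∈ Subgroup.centralizer ({c} : Set ↥(unitaryGroupOfForm σ J)) := mem_centralizer_of_coe_eq_block σ hc hτ
    have hτt : τ ∈ Subgroup.centralizer ({t} : Set ↥(unitaryGroupOfForm σ J)) := ramifiedTorusBlock_mem_centralizer σ hd0 hτ hte hC hBC hπ₀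
    -- the element `k := r(2a+1)⁻¹ τ⁻¹ g` and its matrix
    have hϖa0 : ϖ ^ (a + 1) ≠ 0 := pow_ne_zero _ hϖ0
    set m : K := l * v * μ * ϖ ^ (a + 1) / ϖ ^ N with hm
    have hvm : Valued.v m = 1 := by
      rw [hm, map_div₀, map_mul, map_mul, map_mul, map_pow, map_pow, hvϖ, hvμ, mul_one, ← WithZero.exp_log hvl0, ← WithZero.exp_log hvv0]
      simp only [← WithZero.exp_nsmul, ← WithZero.exp_add, ← WithZero.exp_sub, nsmul_eq_mul]
      rw [show WithZero.log (Valued.v l) + WithZero.log (Valued.v v) + ((a + 1 : ℕ) : ℤ) * -1 - (N : ℤ) * -1 = 0 by push_cast; linarith,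
        WithZero.exp_zero]
    set ε₁ : K := π₀ ^ (2 * a + 2) / (ϖ ^ (a + 1)) ^ 2 with hε₁
    have hvε₁ : Valued.v ε₁ = 1 := by
      rw [hε₁, map_div₀, map_pow, map_pow, map_pow, hvπ₀, hvϖ, ← pow_mul, show (a + 1) * 2 = 2 * a + 2 by ring,
        div_self (pow_ne_zero _ hexp0)]
    have hia' : π₀ ^ i = ε₁ * (ϖ ^ (a + 1)) ^ 2 / π₀ := by
      rw [hε₁, hia, div_mul_cancel₀ _ (pow_ne_zero _ hϖa0), eq_div_iff hπ₀0, ← pow_succ]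
    let kM : Matrix (Fin 3) (Fin 3) K := !![-(m * U₀), 0, -(m * U₁ / d); 0, e, 0; m * d * (ε₁ * W₀), 0, m * (ε₁ * W₁)]
    have hprod : ((τ : GL (Fin 3) K) : Matrix (Fin 3) (Fin 3) K) *
        (((r (2 * a + 1) : ↥(unitaryGroupOfForm σ J)) : GL (Fin 3) K) : Matrix (Fin 3) (Fin 3) K) * kM =
        (((g : ↥(unitaryGroupOfForm σ J)) : GL (Fin 3) K) : Matrix (Fin 3) (Fin 3) K) := by
      rw [hτ, hr1 a, block_mul_block, hg]
      simp only [kM, block_mul_block]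
      have c00 : lam * (π₀ * u) / d * (-d * (ϖ ^ (a + 1))⁻¹) * -(m * U₀) +
          lam * (π₀ * v) * (ϖ ^ (a + 1) / d) * (m * d * (ε₁ * W₀)) = α := by
        rw [eα, hm, hia', hlam]; field_simp
      have c02 : lam * (π₀ * u) / d * (-d * (ϖ ^ (a + 1))⁻¹) * -(m * U₁ / d) +
          lam * (π₀ * v) * (ϖ ^ (a + 1) / d) * (m * (ε₁ * W₁)) = β := by
        rw [eβ, hm, hia', hlam]; field_simp
      have c20 : lam * (π₀ * v) * (-d * (ϖ ^ (a + 1))⁻¹) * -(m * U₀) + lam * u * d * (ϖ ^ (a + 1) / d) * (m * d * (ε₁ * W₀)) = γ := by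
        rw [eγ, hm, hia', hlam]; field_simp
      have c22 : lam * (π₀ * v) * (-d * (ϖ ^ (a + 1))⁻¹) * -(m * U₁ / d) + lam * u * d * (ϖ ^ (a + 1) / d) * (m * (ε₁ * W₁)) = δ := by
        rw [eδ, hm, hia', hlam]; field_simp
      ext a' b'
      fin_cases a' <;> fin_cases b' <;> simp <;>
        first | linear_combination c00 | linear_combination c02 | linear_combination c20 | linear_combination c22
    obtain ⟨τ', hτ', k, hk, hgk⟩ := exists_eq_centralizer_mul_rep_mul_flickerKH σ hJ hd r (2 * a + 1) g htH hτc hτt hprod (by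
      intro a' b'
      fin_cases a' <;> fin_cases b' <;> simp [kM, hvm, hvd, he1, hvε₁, hvU₀, hvU₁, hvW₀, hvW₁])
    exact ⟨2 * a + 1, τ', hτ', k, hk, hgk⟩

end Main

end Literature.NumberTheory.Automorphic.UnitaryGroup
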